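import Mathlib.AlgebraicGeometry.EllipticCurve.Affine.Point
import Mathlib.RingTheory.Coprime.Lemmas
import HarnessLib

/-!
# Rational `mn`-torsion from rational `m`- and `n`-torsion (`m`, `n` coprime)

`Proofs` file (theorems only; no definitions, no named facts, no instances) in topic
`NumberTheory/EllipticCurves`, by the cell `abc-iut` (seat abc-iut-L5-t12; support for the Θ-data
constructor of abc-iut-L5-t7, [IUTchIV] Cor. 2.2 (ii) p. 46 / Thm. 1.10 p. 22, where the field
`F := F_mod(√−1, E_{F_mod}[2·3·5])` must make the `2·3·5 = 30`-torsion rational and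
[IUTchI] Def. 3.1 (b) asks for the `2·3 = 6`-torsion). Elementary group theory (Bézout / CRT in the
group of points, Silverman *AEC* III.§2): if every `m`-torsion point and every `n`-torsion point of
`W(L)` lies in a subgroup `H` (e.g. the image of `W(k) → W(L)`, or the fixed points of a Galois
element), and `gcd(m, n) = 1`, then so does every `mn`-torsion point: with `am + bn = 1`,
`T = a·(mT) + b·(nT)` and `mT ∈ W[n]`, `nT ∈ W[m]`.

* (private) `zsmul_mem_of_torsion_of_coprime` — the abstract statement for an additive subgroup
  `H` of any additive commutative group;
* `WeierstrassCurve.torsion_mem_range_baseChange_of_coprime` — the "`k`-rational" phrasing used by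
  `Literature.IUT.HodgeTheaters.InitialThetaData.torsion_six_rational`
  (`T ∈ Set.range (Affine.Point.baseChange k L)`);
* `WeierstrassCurve.torsion_map_eq_self_of_coprime` — the "fixed by `σ`" phrasing
  (`Affine.Point.map σ T = T`).

## References

* [SilvermanAEC2009] J. H. Silverman, *The Arithmetic of Elliptic Curves*, 2nd ed., III.§2, VIII.§1.
* [Mochizuki2012] S. Mochizuki, IUT I, Def. 3.1 (b) p. 61; IUT IV, Thm. 1.10 p. 22.
-/

noncomputable section

open scoped Classical

namespace WeierstrassCurve

universe u v

/-- **Bézout in an abelian group**: if `H` contains every element killed by `m` and every element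
killed by `n`, with `m, n` coprime, then `H` contains every element killed by `m·n`
(`T = a·(m·T) + b·(n·T)` for `a·m + b·n = 1`; private plumbing). [folklore] -/
private theorem zsmul_mem_of_torsion_of_coprime {A : Type u} [AddCommGroup A] (H : AddSubgroup A)
    {m n : ℕ} (hmn : m.Coprime n) (hm : ∀ T : A, (m : ℤ) • T = 0 → T ∈ H)
    (hn : ∀ T : A, (n : ℤ) • T = 0 → T ∈ H) (T : A) (hT : ((m * n : ℕ) : ℤ) • T = 0) : T ∈ H := by
  obtain ⟨a, b, hab⟩ := Nat.isCoprime_iff_coprime.mpr hmn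
  have hmT : (n : ℤ) • ((m : ℤ) • T) = 0 := by
    rw [← mul_smul, mul_comm, ← Nat.cast_mul]; exact hT
  have hnT : (m : ℤ) • ((n : ℤ) • T) = 0 := by
    rw [← mul_smul, ← Nat.cast_mul]; exact hT
  have hdecomp : T = a • ((m : ℤ) • T) + b • ((n : ℤ) • T) := by
    rw [← mul_smul, ← mul_smul, ← add_smul, hab, one_smul]
  rw [hdecomp]
  exact H.add_mem (H.zsmul_mem (hn _ hmT) a) (H.zsmul_mem (hm _ hnT) b)

variable {k : Type u} {L : Type v} [Field k] [Field L] [Algebra k L] (W : WeierstrassCurve k)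

/-- **Rational `mn`-torsion from rational `m`- and `n`-torsion** (`gcd(m, n) = 1`): if every point
of `W(L)` killed by `m` and every point killed by `n` is in the image of `W(k) → W(L)`, so is every
point killed by `m·n` (e.g. `6 = 2·3`, `30 = 6·5` for [IUTchI] Def. 3.1 (b) / [IUTchIV] Thm. 1.10).
Silverman *AEC* III.§2 (group structure), VIII.§1. [cite: SilvermanAEC2009, III.§2 and VIII.§1] -/
theorem torsion_mem_range_baseChange_of_coprime {m n : ℕ} (hmn : m.Coprime n)
    (hm : ∀ T : (W.baseChange L).toAffine.Point, (m : ℤ) • T = 0 →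
      T ∈ Set.range (Affine.Point.baseChange (W' := W.toAffine) k L))
    (hn : ∀ T : (W.baseChange L).toAffine.Point, (n : ℤ) • T = 0 →
      T ∈ Set.range (Affine.Point.baseChange (W' := W.toAffine) k L))
    (T : (W.baseChange L).toAffine.Point) (hT : ((m * n : ℕ) : ℤ) • T = 0) :
    T ∈ Set.range (Affine.Point.baseChange (W' := W.toAffine) k L) := by
  have h := zsmul_mem_of_torsion_of_coprime
    (Affine.Point.baseChange (W' := W.toAffine) k L).range hmn
    (fun T hT => AddMonoidHom.mem_range.mpr (hm T hT))
    (fun T hT => AddMonoidHom.mem_range.mpr (hn T hT)) T hT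
  exact AddMonoidHom.mem_range.mp h

/-- **`mn`-torsion fixed by `σ` from `m`- and `n`-torsion fixed by `σ`** (`gcd(m, n) = 1`), for an
`L`-algebra endomorphism `σ` over `k` acting on `W(L)` by `Affine.Point.map` (the fixed points form a
subgroup). [cite: SilvermanAEC2009, III.§2 and VIII.§1] -/
theorem torsion_map_eq_self_of_coprime (σ : L →ₐ[k] L) {m n : ℕ} (hmn : m.Coprime n)
    (hm : ∀ T : (W.baseChange L).toAffine.Point, (m : ℤ) • T = 0 → Affine.Point.map σ T = T)
    (hn : ∀ T : (W.baseChange L).toAffine.Point, (n : ℤ) • T = 0 → Affine.Point.map σ T = T)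
    (T : (W.baseChange L).toAffine.Point) (hT : ((m * n : ℕ) : ℤ) • T = 0) :
    Affine.Point.map σ T = T := by
  -- the fixed points of the additive map `Point.map σ` form a subgroup
  let H : AddSubgroup (W.baseChange L).toAffine.Point :=
    { carrier := {P | Affine.Point.map σ P = P}
      add_mem' := fun {P Q} hP hQ => by
        simp only [Set.mem_setOf_eq] at hP hQ ⊢
        rw [map_add, hP, hQ]
      zero_mem' := by simp only [Set.mem_setOf_eq, map_zero]
      neg_mem' := fun {P} hP => by
        simp only [Set.mem_setOf_eq] at hP ⊢
        rw [map_neg, hP] }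
  exact zsmul_mem_of_torsion_of_coprime H hmn hm hn T hT

end WeierstrassCurve
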